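import Summits.CriticalPhenomena.PercolationContinuityZ3.Theses.PercNearOneGluing
import Literature.Probability.Percolation.PercolationProofs
import Literature.Probability.Percolation.ConditionalPositiveAssociationProofs
import Literature.Probability.Percolation.TwoClusterConditionalAssociationProofs

/-! TTRL-lite variant V211 of stmt-CriticalPhenomena-4576 -/

namespace Summit.CriticalPhenomena.PercolationContinuityZ3.Theorems

open MeasureTheory Literature.Probability.LatticeModels Literature.Probability.Percolation
open scoped Classical BigOperators

/-- TTRL-lite variant V211 of the additive-gluing good step (stmt-CriticalPhenomena-4576):
under `n ≤ 4`, `A.card = 3`, `o ∉ A` and a further vertex `y ∉ A`, `y ≠ o`, the vertex type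
`Fin n` would need at least five elements, so the hypotheses are contradictory and the bound
holds vacuously. -/
theorem cp4576_goodstep_var211 :
    ∀ (n : ℕ) (w : Sym2 (Fin n) → unitInterval) (A : Finset (Fin n)) (o b : Fin n), n ≤ 4 →
      A.card = 3 → b ∈ A → o ∉ A → (∃ y : Fin n, y ∉ A ∧ y ≠ o ∧ (w s(o, y) : ℝ) ≠ 0) →
      (∀ w' : Sym2 (Fin n) → unitInterval,
        (Finset.univ.filter (fun v : Fin n => ∃ u : Fin n, 0 < (w' s(u, v) : ℝ))).card <
          (Finset.univ.filter (fun v : Fin n => ∃ u : Fin n, 0 < (w s(u, v) : ℝ))).card →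
        ∀ (A' : Finset (Fin n)) (o' b' : Fin n), b' ∈ A' → o' ∉ A' →
          ∀ (t : ℝ) (sel : Finset (Fin n) → Fin n), (∀ W, sel W ∈ A') →
            (∀ a ∈ A', 1 - t ≤ (prodBernoulli w').real (openConn a b')) →
            (prodBernoulli w').real ((⋃ a ∈ A', openConn o' a) ∩ (openConn o' b')ᶜ) +
              ∑ W ∈ (Finset.univ : Finset (Finset (Fin n))).filter
                  (fun W => o' ∈ W ∧ Disjoint W A'),
                (prodBernoulli w').real
                    {ω : BondConfig (Fin n) | openCluster ω o' = (W : Set (Fin n))} *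
                  (prodBernoulli w').real (openConnIn ((W : Set (Fin n))ᶜ) (sel W) b')ᶜ ≤ t) →
      ∀ (t : ℝ) (sel : Finset (Fin n) → Fin n), (∀ W, sel W ∈ A) →
        (∀ a ∈ A, 1 - t ≤ (prodBernoulli w).real (openConn a b)) →
        (prodBernoulli w).real ((⋃ a ∈ A, openConn o a) ∩ (openConn o b)ᶜ) +
          ∑ W ∈ (Finset.univ : Finset (Finset (Fin n))).filter
              (fun W => o ∈ W ∧ Disjoint W A),
            (prodBernoulli w).real
                {ω : BondConfig (Fin n) | openCluster ω o = (W : Set (Fin n))} *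
              (prodBernoulli w).real (openConnIn ((W : Set (Fin n))ᶜ) (sel W) b)ᶜ ≤ t := by
  intro n w A o b hn hA _ ho hy
  exfalso
  obtain ⟨y, hyA, hyo, -⟩ := hy
  have hoy : o ∉ insert y A := by
    simp only [Finset.mem_insert, not_or]
    exact ⟨fun h => hyo h.symm, ho⟩
  have h1 : (insert o (insert y A)).card = 5 := by
    rw [Finset.card_insert_of_notMem hoy, Finset.card_insert_of_notMem hyA, hA]
  have h2 : (insert o (insert y A)).card ≤ n := by
    calc (insert o (insert y A)).card ≤ Fintype.card (Fin n) := Finset.card_le_univ _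
      _ = n := Fintype.card_fin n
  omega

end Summit.CriticalPhenomena.PercolationContinuityZ3.Theorems
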